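import Mathlib
import Literature.Analysis.FluidPDE.Tao2016AveragedNS.SelfSimilarCascadeBlowup
import Summits.NavierStokesRegularity.NavierStokesRegularity.Theorems.WakeRatchetAdmissibleEternalBound.Negative.AdmissibleEternalBoundFalseOfSymmetricBounceWaves
import HarnessLib
import HarnessLib.Audit

/-!
# `WakeRatchet.AdmissibleEternalBound` (stmt-NavierStokesRegularity-23197) — negative lemma modulo
# SYMMETRIC DSS WAVES: an admissible DSS blow-up wave of an anti-symmetric comparable table whose
# residual vectors are fixed by the anti-symmetry

The companion file `AdmissibleEternalBoundFalseOfSymmetricBounceWaves` refutes the crux modulo an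
admissible eternal solution with a `g`-fixed terminal profile that blows up at its own `t⋆`
(`SymmetricBounceWaves`).  This file specialises the construction to the tree's discretely
self-similar waves (`IsDSSWave`, `dssEmbed`): for the eternal solution carried by a DSS wave,
`W_n(σ) = Φ_{π^n r₀}(σ - nT)`, ALL terminal vectors are rescaled residual vectors of the finitely many
profiles, `r_n = e^{nT} Φ_∞(π^n r₀)` with `Φ_∞(ρ) = lim_{x→∞} e^{x} Φ_ρ(x)` (`tendsto_terminal_dssEmbed`),
and the wave blows up at its own `t⋆` as soon as one profile on the orbit is non-zero somewhere
(`blowup_dssEmbed`: `e^{nT + x₀}‖Φ_{r₀}(x₀)‖ → ∞` along the returns `n ∈ |π|ℕ`).  Hence: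

* `SymmetricDSSWaves` (construction item, `@[conjecture]`): at some spread `R ≥ 1` and arbitrarily
  small scale ratios, an anti-symmetric table of E₂(R) carries a non-trivial admissible DSS wave whose
  residual vectors `Φ_∞(ρ)` are fixed by the anti-symmetry (for a parity-graded table: the odd
  components of the residual vectors vanish — one real condition per odd mode and profile);
* `symmetricBounceWaves_of_symmetricDSSWaves`, `AdmissibleEternalBound_false_of_SymmetricDSSWaves`.

Compare stmt-21808 (`TailRatchet`), refuted modulo ANY non-trivial dyadic DSS front
(`TailRatchetFalseOfDyadicScalarFronts`): here the scalar dyadic member cannot serve (its only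
anti-symmetry is `-id`, and a zero residual is impossible, tree `IsDSSWave.eq_zero_of_residue_zero`);
a graded table with at least one odd mode and one tuned coefficient is needed.  MODEL lattice ODEs
only (Tao 2016 §4, §6.4); nothing here concerns the Navier–Stokes equations; nothing is settled
unconditionally.
-/

noncomputable section

set_option linter.dupNamespace false

namespace Summit.NavierStokesRegularity.NavierStokesRegularity.Theorems

namespace WakeRatchetBounce

open Filter Topology MeasureTheory Set
open scoped RealInnerProductSpace
open Literature.Analysis.FluidPDE Literature.Analysis.FluidPDE.TaoCascade

variable {m : ℕ} {ρ : Type*} [Fintype ρ]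

omit [Fintype ρ] in
/-- **Terminal vectors of a DSS wave are rescaled profile residuals**: if `e^{x}Φ_ρ(x) → Φ_∞(ρ)` for the
profiles on the orbit, then `e^{σ} W_n(σ) → e^{nT} Φ_∞(π^n r₀)` for `W = dssEmbed π T Φ r₀`.
[cite: Tao2016AveragedNS, §4 Lemma 4.1 (4.8), §6.4; cell vocabulary (`dssEmbed`)] -/
theorem tendsto_terminal_dssEmbed {π : Equiv.Perm ρ} {T : ℝ} {Φ : ρ → ℝ → Em m} {Φinf : ρ → Em m}
    (hlim : ∀ r, Tendsto (fun x : ℝ => Real.exp x • Φ r x) atTop (𝓝 (Φinf r))) (r₀ : ρ) (n : ℤ) :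
    Tendsto (fun σ : ℝ => Real.exp σ • dssEmbed π T Φ r₀ n σ) atTop
      (𝓝 (Real.exp (n * T) • Φinf ((π ^ n) r₀))) := by
  have hshift : Tendsto (fun σ : ℝ => σ - n * T) atTop atTop := tendsto_atTop_add_const_right _ _ tendsto_id
  have h := ((hlim ((π ^ n) r₀)).comp hshift).const_smul (Real.exp (n * T))
  refine h.congr fun σ => ?_
  simp only [Function.comp_apply, dssEmbed, smul_smul, ← Real.exp_add]
  congr 1; ring_nf

/-- **A non-trivial DSS wave blows up at its own `t⋆`**: `sup_{n,σ} e^{σ}‖W_n(σ)‖ = ∞` for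
`W = dssEmbed π T Φ r₀` as soon as `T > 0` and `Φ_{r₀}(x₀) ≠ 0` (along the returns of the orbit,
`e^{σ}‖W_n(σ)‖ = e^{nT + x₀}‖Φ_{r₀}(x₀)‖`).
[cite: Tao2016AveragedNS, §4, §6.4; cell vocabulary (`dssEmbed`)] -/
theorem blowup_dssEmbed {π : Equiv.Perm ρ} {T : ℝ} {Φ : ρ → ℝ → Em m} (hT : 0 < T) {r₀ : ρ}
    {x₀ : ℝ} (hne : Φ r₀ x₀ ≠ 0) (K : ℝ) :
    ∃ (n : ℤ) (σ : ℝ), K < Real.exp σ * ‖dssEmbed π T Φ r₀ n σ‖ := by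
  have hc : 0 < ‖Φ r₀ x₀‖ := norm_pos_iff.2 hne
  -- the returns `n = N·|π|`: log-times `nT + x₀ → ∞`
  have h1 : Tendsto (fun N : ℕ => ((N * orderOf π : ℕ) : ℝ) * T + x₀) atTop atTop := by
    refine tendsto_atTop_add_const_right _ _ (Tendsto.atTop_mul_const hT ?_)
    refine tendsto_natCast_atTop_atTop.comp ?_
    exact Filter.tendsto_id.atTop_mul_const' (orderOf_pos π) |>.congr fun N => rfl
  have h2 : Tendsto (fun N : ℕ => Real.exp (((N * orderOf π : ℕ) : ℝ) * T + x₀) * ‖Φ r₀ x₀‖)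
      atTop atTop := (Real.tendsto_exp_atTop.comp h1).atTop_mul_const hc
  obtain ⟨N, hN⟩ := (h2.eventually_gt_atTop K).exists
  refine ⟨((N * orderOf π : ℕ) : ℤ), ((N * orderOf π : ℕ) : ℝ) * T + x₀, ?_⟩
  have hret : dssEmbed π T Φ r₀ ((N * orderOf π : ℕ) : ℤ) (((N * orderOf π : ℕ) : ℝ) * T + x₀)
      = Φ r₀ x₀ := by
    simp only [dssEmbed, perm_zpow_mul_orderOf_apply, Int.cast_natCast]; ring_nf
  rw [hret]
  exact hN

/-- **A symmetric DSS wave is a symmetric bounce wave.**  An admissible DSS wave with residual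
vectors fixed by an anti-symmetry `g` of the table, non-zero somewhere on the orbit of `r₀`, embeds
as an admissible eternal solution whose terminal profile is `g`-fixed and which blows up at its own `t⋆`.
[cite: Tao2016AveragedNS, §4, §6.4; cell vocabulary (`IsDSSWave`, `dssEmbed`, `IsEternal`)] -/
theorem bounceData_of_dssWave {ε₀ : ℝ} {α : Fin m → Fin m → Fin m → ℤ × ℤ × ℤ → ℝ}
    {π : Equiv.Perm ρ} {T : ℝ} {Φ : ρ → ℝ → Em m} (h : IsDSSWave ε₀ α π T Φ)
    (g : Em m →L[ℝ] Em m) {Φinf : ρ → Em m}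
    (hlim : ∀ r, Tendsto (fun x : ℝ => Real.exp x • Φ r x) atTop (𝓝 (Φinf r)))
    (hfix : ∀ r, g (Φinf r) = Φinf r) {r₀ : ρ} {x₀ : ℝ} (hne : Φ r₀ x₀ ≠ 0) :
    IsEternal ε₀ α (dssEmbed π T Φ r₀) ∧
      (∃ r : ℤ → Em m, (∀ n, Tendsto (fun σ : ℝ => Real.exp σ • dssEmbed π T Φ r₀ n σ) atTop
        (𝓝 (r n))) ∧ ∀ n, g (r n) = r n) ∧
      ∀ K : ℝ, ∃ (n : ℤ) (σ : ℝ), K < Real.exp σ * ‖dssEmbed π T Φ r₀ n σ‖ :=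
  ⟨h.isEternal_dssEmbed r₀,
    ⟨fun n => Real.exp (n * T) • Φinf ((π ^ n) r₀), tendsto_terminal_dssEmbed hlim r₀,
      fun n => by rw [map_smul, hfix]⟩,
    blowup_dssEmbed h.delay_pos hne⟩

/-! ## The construction item (DSS form) and the negative lemma -/

/-- **The construction `AdmissibleEternalBound` is refuted modulo, DSS form: SYMMETRIC DSS WAVES at
arbitrarily small scale ratios.**  At some spread `R ≥ 1`, for every `ε > 0` there are `ε₀ ∈ (0, ε]`,
a table `α ∈ E₂(R)` with a linear anti-symmetry `g` (`Q∘g = -g∘Q`, `A∘g = -g∘A`, `B∘(g×g) = -g∘B`),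
and an admissible DSS wave of `α` (profile family `Φ : Fin q → ℝ → Em 4`, shape permutation `π`,
delay `T > 0`) that is non-zero somewhere and whose residual vectors `Φ_∞(ρ) = lim e^{x}Φ_ρ(x)`
(they exist for every admissible wave, `WakeRatchetTerminal.exists_terminalProfile`) are `g`-fixed.
For a parity-graded table this asks the ODD components of the residual vectors to vanish.  No DSS
blow-up wave of any comparable table is constructed in print.
[cite: Tao2016AveragedNS, §4 Lemma 4.1 (4.8), §6.4; cell vocabulary (construction item for stmt-23197)] -/
@[conjecture] def SymmetricDSSWaves : Prop :=
  ∃ R : ℝ, 1 ≤ R ∧ ∀ εs : ℝ, 0 < εs → ∃ ε₀ : ℝ, 0 < ε₀ ∧ ε₀ ≤ εs ∧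
    ∃ α : Fin 4 → Fin 4 → Fin 4 → ℤ × ℤ × ℤ → ℝ, InTableClass R α ∧
    ∃ g : Em 4 →L[ℝ] Em 4,
      (∀ x, tableQ α (g x) = -(g (tableQ α x))) ∧ (∀ x, tableA α (g x) = -(g (tableA α x))) ∧
      (∀ y x, tableB α (g y) (g x) = -(g (tableB α y x))) ∧
    ∃ (q : ℕ) (π : Equiv.Perm (Fin q)) (T : ℝ) (Φ : Fin q → ℝ → Em 4),
      IsDSSWave ε₀ α π T Φ ∧
      (∀ r : Fin q, ∃ v : Em 4, Tendsto (fun x : ℝ => Real.exp x • Φ r x) atTop (𝓝 v) ∧ g v = v) ∧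
      ∃ (r₀ : Fin q) (x₀ : ℝ), Φ r₀ x₀ ≠ 0

/-- Symmetric DSS waves are symmetric bounce waves.
[cite: Tao2016AveragedNS, §4, §6.4; cell vocabulary (stmt-NavierStokesRegularity-23197)] -/
theorem symmetricBounceWaves_of_symmetricDSSWaves : SymmetricDSSWaves → SymmetricBounceWaves := by
  rintro ⟨R, hR, H⟩
  refine ⟨R, hR, fun εs hεs => ?_⟩
  obtain ⟨ε₀, hε₀, hle, α, hα, g, hgQ, hgA, hgB, q, π, T, Φ, hW, hres, r₀, x₀, hne⟩ := H εs hεs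
  choose Φinf hlim hfix using hres
  obtain ⟨hE, hterm, hblow⟩ := bounceData_of_dssWave hW g hlim hfix hne
  exact ⟨ε₀, hε₀, hle, α, hα, g, hgQ, hgA, hgB, dssEmbed π T Φ r₀, hE, hterm, hblow⟩

/-- **Negative lemma (DSS form): `SymmetricDSSWaves → ¬ AdmissibleEternalBound`.**
[cite: Tao2016AveragedNS, §4, §6.4; cell vocabulary (stmt-NavierStokesRegularity-23197)] -/
theorem AdmissibleEternalBound_false_of_SymmetricDSSWaves :
    SymmetricDSSWaves →
      ¬ Summit.NavierStokesRegularity.NavierStokesRegularity.Theses.WakeRatchet.AdmissibleEternalBound :=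
  fun h => AdmissibleEternalBound_false_of_SymmetricBounceWaves (symmetricBounceWaves_of_symmetricDSSWaves h)

end WakeRatchetBounce

end Summit.NavierStokesRegularity.NavierStokesRegularity.Theorems
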